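import Literature.MathematicalPhysics.QuantumFieldTheory.Balaban1983to89.B9Letters313AtOneL2Dv
import Literature.MathematicalPhysics.QuantumFieldTheory.Balaban1983to89.B9Letters313AtOneDir

/-!
# `Balaban1983to89.B9Letters313AtOneL2Dir` — [B9] Thm 3.13's BLOCK-L² reduction letters AT THE TRIVIAL BACKGROUND, third batch: the DIRECTION-WISE
# letters `Letters313L2MZ.dGQsd ν ∕ dGDvd ν` (`‖1_{Δ(y)}∇_{U,ν}G₀(1)Q*(1)ω‖`, `‖1_{Δ(y)}∇_{U,ν}G₀(1)D_v(1)λ‖`) HOLD AT `U = 1`, uniformly on the census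

T. Bałaban, *Propagators for lattice gauge theories in a background field*, Commun. Math. Phys. **99** (1985) 389–434
[`Balaban1985BackgroundPropagators`, "B9"]; [4] = T. Bałaban, *Propagators and renormalization transformations for lattice gauge
theories. II*, Commun. Math. Phys. **96** (1984) 223–250 [`Balaban1984PropagatorsII`].

statement-level skeleton of published theorems with citation tags; proofs where landed; nothing here is a claim about the Yang–Mills mass gap

THE PRINTED LOCI (verbatim).  [B9] p. 426 (Thm 3.13), (3.153); (3.46) p. 398; (3.133) p. 422; Cor. 3.5 p. 407; [4] Prop. 2.6 (2.140) p. 247 (members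
`‖ζ∇GJ‖`, `‖ζ∇G∇*J‖`), Lemma 2.1 (2.60)–(2.61) p. 234.

THE POINT.  dag-n06-d's certificate (ed. 22) displays `hLL2 : … ∧ Letters313L2MZ (𝔬12 x) (𝔡A x).Dd (𝔡A x).Dsd 1 (H x) B13₄ δ12₃ (√wZ) … U` with the
direction-indexed derivative PINNED to the constant family of ONE covariant derivative (`h𝔡Ad : (𝔡A x).Dd U = fun μ => coordOpK (trBasis N) (fun _ =>
∇_{U,μ})`).  THIS FILE inhabits its fields `dGQsd ν` and `dGDvd ν` at `U ↦ 1` (sequel of `B9Letters313AtOneL2 ∕ …L2Dv`, same engines): the pinned composites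
are the mixed models of `∇_{1,ν} ∘ O(1) ∘ Q*(1)` (this seat's g0 `B9Letters313AtOneDir.coordOpK_cdB_GcoK_comp_QscoKH_one`) and `∇_{1,ν} ∘ O(1) ∘ D_1`
(`coordOpK_cdB_GcoK_comp_DvcoKH_one`), read through the slices with (2.140)₁ (`∇_νG`, one power of `Lʲη` transferred) resp. (2.140)₄ (`∇_νG∇*_μ`): ★★★
`blockBd_Dd_G0_Qstar_one`, ★★★ `blockBd_Dd_G0_Dv_one`, ★★★ `letters313_L2M_one_kIdx` (both, every `ν`, uniformly on the census).

HONEST SCOPE.  A READING file, inputs cited by name; nothing of [B9] at curved `U` asserted; `hLL2` NOT witnessed (A6 partial witnesses at `U = 1`);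
`Letters313L2MZ.rgdDd` (R-letter) NOT treated.  COUNT-NEUTRAL; N06 NOT discharged; one finite lattice at a time; nothing continuum, nothing about the mass gap.
Cell `pub-ymgap` (HUMAN RULING D-0062 ∕ D-0149), node N06 [B9], rows 20–21 JSAT lane, width seat `pub-ymgap-dag-n06-w3` (g2), 2026-08-28.
-/

noncomputable section

namespace Literature.MathematicalPhysics.QuantumFieldTheory.Balaban1983to89.B9Letters313AtOneL2Dir

open B6MultiLevelTorusOperator (TDomains) open B6Geom246MultiLevelTorus (geomT) open B6GlobalChartV1 (PV blkV1 boxEquiv toBox)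
open B6KLevelCensusIndexV1 (KIdx kGeo kGeoG) open B6Prop26Census2136KLevelV1 (Gop) open B6GradLegKLevelV1 (DV) open B6LapLegKLevelV1 (DVa)
open B6Ineq2142KLevelV1 (lvl β) open B9Thm314GpFlatMultiLevelTorus (consts_260_261) open B6Lemma21Repaired (Ineq261With) open B9GeoNormsKLevelV1 (geo9K)
open B9GeoLemma21KLevelV1 (one_le_Mh geo9K_len_pos geo9K_dist_comm geo9K_M_nonneg) open B9Thm39ReadingCoords (cR39 cR39_nonneg)
open B9CoReadingCoords B9CoReadingCoordsH open B9CoReadingCoordsS (XSK blkSK sIK) open B9Thm34Ext (toB6) open B9SectDL2Decay (bsq bl2 BlockBd)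
open B9LettersHAtOneG0 (cdB_O_QsY_one_liftY) open B9Letters313AtOneQ (len_pow_le_of_transfer transfer_threshold)
open B9Letters313AtOneDv (GcoK_comp_DvcoKH_one) open B9Letters313AtOneDir (coordOpK_cdB_GcoK_comp_QscoKH_one)
open B9Prop26L2AtPinsOne (blockBd_Gop_kIdx) open B9BlockL2ReblockEngine (blockBd_comp_reblock)
open B9Letters313AtOneL2 (blockBd_coordOpKH_of_liftY blockBd_smul_of_nonneg blockBd_comp_qsK_bI)
open B9Letters313AtOneL2Dv (cdB_O_gradY_one_liftY blockBd_comp_gradK_sIK_bI) open Node00 Node00.OpsYSectDCoords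
open B9Thm312Whole
open scoped Matrix

variable {d ℓ : ℕ} {hd : 1 ≤ d + 1} {hL : Odd (ℓ + 1) ∧ 1 < ℓ + 1} {b₀ b₁ : ℝ}

section Dir

variable {𝔸 : Type} [NormedRing 𝔸] [NormedAlgebra ℂ 𝔸] [CompleteSpace 𝔸] [FiniteDimensional ℝ 𝔸]
variable {κ : Type} [Fintype κ]
variable (i : KIdx d ℓ hd hL b₀ b₁) (b : Module.Basis κ ℝ 𝔸) (B : B9.Backgrounds) (cfg : B.Cfg → CfgY 𝔸 i) (O : BondOpY 𝔸 i) (parB : BondParY 𝔸 i)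
variable {Y Z W : Type}

/-- ★ the pinned single-direction derivative after `G₀D_v`, at `U = 1`, is the mixed model of `∇_{1,μ} ∘ O(1) ∘ D_1`.
[cite: Balaban1985BackgroundPropagators, (3.42) p.397, (3.3) p.390, Cor. 3.5 p.407, dictionary] -/
theorem coordOpK_cdB_GcoK_comp_DvcoKH_one {U₁ : B.Cfg} (hU₁ : cfg U₁ = fun _ _ => 1) (μ : Fin (d + 1)) :
    coordOpK b (fun _ : Fin (d + 1) => cdBₗ i (cfg U₁) μ) ∘ₗ GcoK i b B cfg O U₁ ∘ₗ DvcoKH i b B cfg U₁ =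
      cR39 b • coordOpKH b (fun _ : Fin (d + 1) => cdBₗ i (fun _ _ => 1) μ ∘ₗ (O (fun _ _ => 1)).restrictScalars ℝ ∘ₗ
        (gradY i (fun _ _ => 1)).restrictScalars ℝ) := by
  rw [GcoK_comp_DvcoKH_one i b B cfg O hU₁, hU₁, LinearMap.comp_smul, coordOpK_comp_coordOpKH]

/-- ★★★ **THE LETTER `dGQsd ν` OF `Letters313L2MZ` AT `U = 1`** — `‖1_{Δ(y)}∇_{U₁,ν}G₀(1)Q*(1)ω‖ ≤ B·(√wZ y′·L^{j′}η)·e^{−(¾δ−ε)d}‖ω‖`, pins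
`hG0co12 ∕ hQsco12 ∕ h𝔡Ad`, `hblk12 ∕ hblkZ12`, one power of `Lʲη` transferred by (2.60).
[cite: Balaban1985BackgroundPropagators, Thm 3.13 p.426, (3.46) p.398, (3.133) p.422, Cor. 3.5 p.407; Balaban1984PropagatorsII, Prop. 2.6 (2.140) p.247, Lemma 2.1 (2.60)–(2.61) p.234] -/
theorem blockBd_Dd_G0_Qstar_one (hG : GeoOK (geo9K i)) [Fintype (geo9K i).Site]
    (hc : cR39 b ≠ 0) (hparB : ∀ s s', parB (fun _ _ => 1) s s' = 1)
    (hO : ∀ (J : FBondY i → ℝ) (E : 𝔸), O (fun _ _ => 1) (liftY J E) = liftY (Gop i J) E) {U₁ : B.Cfg} (hU₁ : cfg U₁ = fun _ _ => 1)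
    {bI : FBondY i → IBondY i} (hlev : ∀ f : FBondY i, lvl i.hN i.D i.hk (bI f) = (blkV1 i.hN i.D f).1.1)
    (hβ1 : ∀ f : FBondY i, (geomT i.D).dist (β i.hN i.D i.hk (bI f)) (blkV1 i.hN i.D f) ≤ 1)
    (𝔬 : Ops (geo9K i) B (XBK κ i) Y (XHK κ i) W) (hblk : 𝔬.blk = blkBK i bI) (hblkZ : 𝔬.blkZ = blkHK i)
    (hG0 : 𝔬.G0 U₁ = GcoK i b B cfg O U₁) (hQs : 𝔬.Qstar U₁ = QscoKH i b B cfg parB U₁)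
    (Dd : B.Cfg → Fin (d + 1) → Module.End ℝ (XBK κ i → ℝ)) (hDd : Dd U₁ = fun μ => coordOpK b (fun _ : Fin (d + 1) => cdBₗ i (cfg U₁) μ))
    {C δ c : ℝ} (hC : 0 ≤ C) (hδ : 0 ≤ δ) (hc0 : 0 ≤ c)
    (hT : ∀ ν : Fin (d + 1), BlockBd (g := geomT i.D) (blkV1 i.hN i.D) (blkV1 i.hN i.D) (DV ν i.cf ∘ₗ Gop i)
      (fun y y' => C * |i.cf|⁻¹ ^ 1 * ((ℓ : ℝ) + 1) ^ (1 * y.1.1) * Real.exp (-(δ * (geomT i.D).dist y y'))))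
    (h261 : Ineq261With c (geomT i.D) δ (1 / 4)) {ε : ℝ} (hε : 0 < ε)
    (hM : Real.log (geo9K i).L ≤ ε * (2 * ((ℓ : ℝ) + 1) ^ 2 - 1) * (geo9K i).M) (ν : Fin (d + 1)) {R₀ : ℝ} {H₀ : Prop} :
    BlockBd (g := toB6 (geo9K i) R₀ H₀) 𝔬.blkZ 𝔬.blk (Dd U₁ ν ∘ₗ 𝔬.G0 U₁ ∘ₗ 𝔬.Qstar U₁)
      (fun y y' => C * c * Real.exp (3 / 4 * δ * ((ℓ : ℝ) + 4)) * Real.sqrt (Real.exp (1 / 4 * δ) * c) * (geo9K i).L *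
        (Real.sqrt (((((ℓ + 1 : ℕ) : ℝ) ^ (d + 1)) ^ lvl i.hN i.D i.hk y')⁻¹) * (geo9K i).len y') *
        Real.exp (-((3 / 4 * δ - ε) * (geo9K i).dist y y'))) := by
  rw [hblk, hblkZ, hG0, hQs, hDd]
  beta_reduce
  rw [coordOpK_cdB_GcoK_comp_QscoKH_one i b B cfg O parB hc hU₁ ν]
  have hK := blockBd_coordOpKH_of_liftY b (G := toB6 (geo9K i) R₀ H₀) (blk' := fun a : IBondY i => a) (blk := bI)
    (T := fun _ : Fin (d + 1) => (DV ν i.cf ∘ₗ Gop i) ∘ₗ Matrix.toLin' (qsK i)) (fun _ ω E => cdB_O_QsY_one_liftY i O parB hparB hO ν ω E) ?_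
    fun _ => blockBd_comp_qsK_bI i hlev hβ1 hC hδ 1 (hT ν) h261 R₀ H₀
  swap
  · intro a a'; have := (hG.lenpos a).le; positivity
  refine B9SectDL2Decay.BlockBd.mono hK fun y y' => ?_
  have ht : (geo9K i).len y ^ 1 ≤ (geo9K i).L ^ 1 * Real.exp (ε * (geo9K i).dist y' y) * (geo9K i).len y' ^ 1 :=
    len_pow_le_of_transfer i hε 1 (by rwa [Nat.cast_one, one_mul]) y' y
  rw [pow_one, pow_one, pow_one, geo9K_dist_comm i y' y] at ht
  rw [show ((ℓ : ℝ) + 3) + 1 = (ℓ : ℝ) + 4 by ring]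
  set A : ℝ := C * c * Real.exp (3 / 4 * δ * ((ℓ : ℝ) + 4)) * Real.sqrt (Real.exp (1 / 4 * δ) * c) with hA
  set v : ℝ := Real.sqrt (((((ℓ + 1 : ℕ) : ℝ) ^ (d + 1)) ^ lvl i.hN i.D i.hk y')⁻¹) with hv
  have hexp : Real.exp (-(3 / 4 * δ * (geo9K i).dist y y')) * Real.exp (ε * (geo9K i).dist y y') =
      Real.exp (-((3 / 4 * δ - ε) * (geo9K i).dist y y')) := by rw [← Real.exp_add]; congr 1; ring
  calc A * (geo9K i).len y ^ 1 * Real.exp (-(3 / 4 * δ * (geo9K i).dist y y')) * v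
      = A * v * Real.exp (-(3 / 4 * δ * (geo9K i).dist y y')) * (geo9K i).len y := by rw [pow_one]; ring
    _ ≤ A * v * Real.exp (-(3 / 4 * δ * (geo9K i).dist y y')) * ((geo9K i).L * Real.exp (ε * (geo9K i).dist y y') * (geo9K i).len y') :=
        mul_le_mul_of_nonneg_left ht (by positivity)
    _ = A * (geo9K i).L * (v * (geo9K i).len y') * (Real.exp (-(3 / 4 * δ * (geo9K i).dist y y')) * Real.exp (ε * (geo9K i).dist y y')) := by ring
    _ = _ := by rw [hexp]

/-- ★★★ **THE LETTER `dGDvd ν` OF `Letters313L2MZ` AT `U = 1`** — `‖1_{Δ(y)}∇_{U₁,ν}G₀(1)D_v(1)λ‖ ≤ B·e^{−¾δd}‖λ‖` (order zero), pins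
`hG0co12 ∕ hDvco12 ∕ h𝔡Ad`, `hblk12`, `blkW = blkSK (sIK bI)`.
[cite: Balaban1985BackgroundPropagators, Thm 3.13 p.426, (3.46) p.398, (3.3) p.390, Cor. 3.5 p.407; Balaban1984PropagatorsII, Prop. 2.6 (2.140) p.247, Lemma 2.1 (2.61) p.234] -/
theorem blockBd_Dd_G0_Dv_one (hG : GeoOK (geo9K i)) [Fintype (geo9K i).Site]
    (hO : ∀ (J : FBondY i → ℝ) (E : 𝔸), O (fun _ _ => 1) (liftY J E) = liftY (Gop i J) E) {U₁ : B.Cfg} (hU₁ : cfg U₁ = fun _ _ => 1)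
    {bI : FBondY i → IBondY i} (hlev : ∀ f : FBondY i, lvl i.hN i.D i.hk (bI f) = (blkV1 i.hN i.D f).1.1)
    (hβ1 : ∀ f : FBondY i, (geomT i.D).dist (β i.hN i.D i.hk (bI f)) (blkV1 i.hN i.D f) ≤ 1)
    (𝔬 : Ops (geo9K i) B (XBK κ i) Y Z (XSK κ i)) (hblk : 𝔬.blk = blkBK i bI) (hblkW : 𝔬.blkW = blkSK i (sIK i bI))
    (hG0 : 𝔬.G0 U₁ = GcoK i b B cfg O U₁) (hDv : 𝔬.Dv U₁ = DvcoKH i b B cfg U₁)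
    (Dd : B.Cfg → Fin (d + 1) → Module.End ℝ (XBK κ i → ℝ)) (hDd : Dd U₁ = fun μ => coordOpK b (fun _ : Fin (d + 1) => cdBₗ i (cfg U₁) μ))
    {C δ c : ℝ} (hC : 0 ≤ C) (hδ : 0 ≤ δ) (hc0 : 0 ≤ c)
    (hT : ∀ ν μ : Fin (d + 1), BlockBd (g := geomT i.D) (blkV1 i.hN i.D) (blkV1 i.hN i.D) (DV ν i.cf ∘ₗ Gop i ∘ₗ DVa (P := PV d ℓ i.m i.K hd hL) μ i.cf)
      (fun y y' => C * |i.cf|⁻¹ ^ 0 * ((ℓ : ℝ) + 1) ^ (0 * y.1.1) * Real.exp (-(δ * (geomT i.D).dist y y'))))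
    (h261 : Ineq261With c (geomT i.D) δ (1 / 4)) (ν : Fin (d + 1)) {R₀ : ℝ} {H₀ : Prop} :
    BlockBd (g := toB6 (geo9K i) R₀ H₀) 𝔬.blkW 𝔬.blk (Dd U₁ ν ∘ₗ 𝔬.G0 U₁ ∘ₗ 𝔬.Dv U₁)
      (fun y y' => cR39 b * (((d : ℝ) + 1) * (C * c * Real.exp (3 / 4 * δ * 3) * Real.sqrt (Real.exp (1 / 4 * δ) * c))) *
        Real.exp (-(3 / 4 * δ * (geo9K i).dist y y'))) := by
  rw [hblk, hblkW, hG0, hDv, hDd]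
  beta_reduce
  rw [coordOpK_cdB_GcoK_comp_DvcoKH_one i b B cfg O hU₁ ν]
  have hK := blockBd_coordOpKH_of_liftY b (G := toB6 (geo9K i) R₀ H₀) (blk' := sIK i bI) (blk := bI)
    (T := fun _ : Fin (d + 1) => (DV ν i.cf ∘ₗ Gop i) ∘ₗ Matrix.toLin' (gradK i)) (fun _ ω E => cdB_O_gradY_one_liftY i O hO ν ω E) ?_
    fun _ => blockBd_comp_gradK_sIK_bI i hlev hβ1 hC hδ 0 (fun μ => by rw [LinearMap.comp_assoc]; exact hT ν μ) h261 R₀ H₀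
  swap
  · intro a a'; positivity
  refine B9SectDL2Decay.BlockBd.mono (blockBd_smul_of_nonneg (G := toB6 (geo9K i) R₀ H₀) hK (cR39_nonneg b)) fun y y' => le_of_eq ?_
  rw [Finset.card_univ, Fintype.card_fin, show (2 : ℝ) + 1 = 3 by norm_num, pow_zero]
  push_cast
  ring

end Dir

/-! ## §2 Uniformly on the k-level census: `dGQsd ν ∧ dGDvd ν` at `U = 1` with the certificate's constants -/

section Record

variable {𝔸 : Type} [NormedRing 𝔸] [NormedAlgebra ℂ 𝔸] [CompleteSpace 𝔸] [FiniteDimensional ℝ 𝔸]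
variable {κ : Type} [Fintype κ] {Y : Type}

/-- ★★★ **`Letters313L2MZ.dGQsd ν` AND `dGDvd ν` AT `U = 1`, EVERY DIRECTION `ν`, UNIFORMLY ON THE k-LEVEL CENSUS.**  There are `M₁, B₄, δ₄ > 0`
(from [4] Prop. 2.6 (2.140) uniformly in `k` — `B9Prop26L2AtPinsOne.blockBd_Gop_kIdx` — and Lemma 2.1's `consts_260_261`) such that for every
index `i` with `M₁ ≤ M`, every letter record `𝔬` over `geo9K i` pinned at a configuration reading `1` as in dag-n06-d's certificate (`hG0co12`,
`hQsco12`, `hDvco12`, `hblk12`, `hblkZ12`, site pin `blkW = blkSK (sIK bI)`) and every direction family pinned by `h𝔡Ad`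
(`Dd U₁ = fun μ => coordOpK b (fun _ => ∇_{U₁,μ})`): for every `ν`,
`BlockBd blkZ blk (Dd U₁ ν ∘ G₀ ∘ Q*)(B₄·(√wZ y′·|Δ(y′)|)·e^{−δ₄d})` and `BlockBd blkW blk (Dd U₁ ν ∘ G₀ ∘ D_v)(B₄·cR39 b·e^{−δ₄d})`, with
`wZ y′ = (L^{(d+1)j′})⁻¹` the certificate's plateau weight (`vZ := √wZ`).  `δ₄ = δ₃∕2`; the `Lʲη` of (2.140)₁ is moved to the source block by (2.60)
(`ε = δ₃∕4`, threshold `4 log L ∕ δ₃ ≤ M`).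
[cite: Balaban1985BackgroundPropagators, Thm 3.13 p.426, (3.46) p.398, (3.133) p.422, (3.42) p.397, (3.3) p.390, Cor. 3.5 p.407; Balaban1984PropagatorsII, Prop. 2.6 (2.140) p.247, Lemma 2.1 (2.60)–(2.61) p.234] -/
theorem letters313_L2M_one_kIdx (hb₀ : 0 < b₀) (hb₁ : b₀ ≤ b₁) : ∃ M₁ B₄ δ₄ : ℝ, 0 < M₁ ∧ 0 < B₄ ∧ 0 < δ₄ ∧
    ∀ i : KIdx d ℓ hd hL b₀ b₁, M₁ ≤ (geo9K i).M → ∀ (hG : GeoOK (geo9K i)) [Fintype (geo9K i).Site]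
      (b : Module.Basis κ ℝ 𝔸), cR39 b ≠ 0 → ∀ (B : B9.Backgrounds) (cfg : B.Cfg → CfgY 𝔸 i) (O : BondOpY 𝔸 i) (parB : BondParY 𝔸 i),
      (∀ s s', parB (fun _ _ => 1) s s' = 1) → (∀ (J : FBondY i → ℝ) (E : 𝔸), O (fun _ _ => 1) (liftY J E) = liftY (Gop i J) E) →
      ∀ {U₁ : B.Cfg}, cfg U₁ = (fun _ _ => 1) → ∀ {bI : FBondY i → IBondY i},
      (∀ f : FBondY i, lvl i.hN i.D i.hk (bI f) = (blkV1 i.hN i.D f).1.1) →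
      (∀ f : FBondY i, (geomT i.D).dist (β i.hN i.D i.hk (bI f)) (blkV1 i.hN i.D f) ≤ 1) →
      ∀ (𝔬 : Ops (geo9K i) B (XBK κ i) Y (XHK κ i) (XSK κ i)),
      𝔬.blk = blkBK i bI → 𝔬.blkZ = blkHK i → 𝔬.blkW = blkSK i (sIK i bI) →
      𝔬.G0 U₁ = GcoK i b B cfg O U₁ → 𝔬.Qstar U₁ = QscoKH i b B cfg parB U₁ → 𝔬.Dv U₁ = DvcoKH i b B cfg U₁ →
      ∀ (Dd : B.Cfg → Fin (d + 1) → Module.End ℝ (XBK κ i → ℝ)),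
      Dd U₁ = (fun μ => coordOpK b (fun _ : Fin (d + 1) => cdBₗ i (cfg U₁) μ)) →
      ∀ (ν : Fin (d + 1)) {R₀ : ℝ} {H₀ : Prop},
        BlockBd (g := toB6 (geo9K i) R₀ H₀) 𝔬.blkZ 𝔬.blk (Dd U₁ ν ∘ₗ 𝔬.G0 U₁ ∘ₗ 𝔬.Qstar U₁)
          (fun y y' => B₄ * (Real.sqrt (((((ℓ + 1 : ℕ) : ℝ) ^ (d + 1)) ^ lvl i.hN i.D i.hk y')⁻¹) * (geo9K i).len y') *
            Real.exp (-(δ₄ * (geo9K i).dist y y'))) ∧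
        BlockBd (g := toB6 (geo9K i) R₀ H₀) 𝔬.blkW 𝔬.blk (Dd U₁ ν ∘ₗ 𝔬.G0 U₁ ∘ₗ 𝔬.Dv U₁)
          (fun y y' => B₄ * cR39 b * Real.exp (-(δ₄ * (geo9K i).dist y y'))) := by
  obtain ⟨M₁, δ₃, C, hM₁, hδ₃, hC, H⟩ := blockBd_Gop_kIdx (d := d) (ℓ := ℓ) (hd := hd) (hL := hL) hb₀ hb₁
  obtain ⟨N, c, -, hc0, hcon⟩ := consts_260_261 d ℓ hδ₃
  set Lr : ℝ := (((ℓ + 1 : ℕ) : ℝ)) with hLr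
  have hLr1 : 1 ≤ Lr := by rw [hLr]; exact_mod_cast Nat.succ_le_succ (Nat.zero_le ℓ)
  set lg : ℝ := Real.log Lr with hlg
  have hlg0 : 0 ≤ lg := Real.log_nonneg hLr1
  set AQ : ℝ := C * c * Real.exp (3 / 4 * δ₃ * ((ℓ : ℝ) + 4)) * Real.sqrt (Real.exp (1 / 4 * δ₃) * c) * Lr with hAQ
  set AD : ℝ := ((d : ℝ) + 1) * (C * c * Real.exp (3 / 4 * δ₃ * 3) * Real.sqrt (Real.exp (1 / 4 * δ₃) * c)) with hAD
  have hAQ0 : 0 ≤ AQ := by positivity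
  have hAD0 : 0 ≤ AD := by positivity
  set B₄ : ℝ := max AQ AD + 1 with hB₄
  have hB₄pos : 0 < B₄ := by have := le_max_left AQ AD; linarith
  have hAQB : AQ ≤ B₄ := by have := le_max_left AQ AD; linarith
  have hADB : AD ≤ B₄ := by have := le_max_right AQ AD; linarith
  refine ⟨max (max M₁ ((N : ℝ) + 1)) (4 * lg / δ₃), B₄, δ₃ / 2, lt_max_of_lt_left (lt_max_of_lt_left hM₁), hB₄pos, by positivity, ?_⟩
  intro i hM hG _ b hc B cfg O parB hparB hO U₁ hU₁ bI hlev hβ1 𝔬 hblk hblkZ hblkW hG0 hQs hDv Dd hDd ν R₀ H₀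
  have hLcast : (((ℓ + 1 : ℕ) : ℝ)) = (ℓ : ℝ) + 1 := by push_cast; ring
  have hMdef : (geo9K i).M = (((ℓ + 1 : ℕ) : ℝ)) * (i.Mh : ℝ) := rfl
  have hLdef : (geo9K i).L = Lr := rfl
  have hM₁ : M₁ ≤ (kGeoG i).M := ((le_max_left _ _).trans (le_max_left _ _)).trans hM
  have hN : (N : ℝ) + 1 ≤ ((ℓ : ℝ) + 1) * i.Mh := by
    rw [← hLcast, ← hMdef]; exact ((le_max_right _ _).trans (le_max_left _ _)).trans hM
  have hMw : 4 * lg ≤ (geo9K i).M * δ₃ := (div_le_iff₀ hδ₃).mp ((le_max_right _ _).trans hM)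
  have hR1 : 1 ≤ i.R := le_trans (by omega) (toKT i).hR
  have hRN : N + 1 ≤ i.R * ((ℓ + 1) * i.Mh) := by
    have h2 : N + 1 ≤ (ℓ + 1) * i.Mh := by exact_mod_cast hN
    calc N + 1 ≤ 1 * ((ℓ + 1) * i.Mh) := by rw [one_mul]; exact h2
      _ ≤ i.R * ((ℓ + 1) * i.Mh) := Nat.mul_le_mul_right _ hR1
  obtain ⟨-, h261⟩ := hcon i.k i.Mh i.R i.P' (one_le_Mh i) (toKT i).hP hRN
  have h261D : Ineq261With c (geomT i.D) δ₃ (1 / 4) := h261 i.D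
  obtain ⟨-, h1, -, h3, -, -⟩ := H i hM₁
  have hε4 : 0 < δ₃ / 4 := by positivity
  have hMg1 : ((1 : ℕ) : ℝ) * lg / (δ₃ / 4) ≤ (geo9K i).M := by rw [div_le_iff₀ hε4]; push_cast; linarith
  have hT1 := transfer_threshold i hε4 1 hMg1
  -- the two bodies
  have hDQ := blockBd_Dd_G0_Qstar_one (W := XSK κ i) (R₀ := R₀) (H₀ := H₀) i b B cfg O parB hG hc hparB hO hU₁ hlev hβ1 𝔬 hblk hblkZ hG0 hQs Dd hDd
    hC.le hδ₃.le hc0 h1 h261D hε4 (by simpa using hT1) ν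
  have hDD := blockBd_Dd_G0_Dv_one (Z := XHK κ i) (R₀ := R₀) (H₀ := H₀) i b B cfg O hG hO hU₁ hlev hβ1 𝔬 hblk hblkW hG0 hDv Dd hDd
    hC.le hδ₃.le hc0 h3 h261D ν
  have hcb : 0 ≤ cR39 b := cR39_nonneg b
  refine ⟨B9SectDL2Decay.BlockBd.mono hDQ fun y y' => ?_, B9SectDL2Decay.BlockBd.mono hDD fun y y' => ?_⟩
  · have hre : Real.exp (-((3 / 4 * δ₃ - δ₃ / 4) * (geo9K i).dist y y')) = Real.exp (-(δ₃ / 2 * (geo9K i).dist y y')) := by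
      congr 1; ring
    rw [hre, hLdef]
    have hX : 0 ≤ (Real.sqrt (((((ℓ + 1 : ℕ) : ℝ) ^ (d + 1)) ^ lvl i.hN i.D i.hk y')⁻¹) * (geo9K i).len y') *
        Real.exp (-(δ₃ / 2 * (geo9K i).dist y y')) := by
      have := (hG.lenpos y').le; positivity
    calc C * c * Real.exp (3 / 4 * δ₃ * ((ℓ : ℝ) + 4)) * Real.sqrt (Real.exp (1 / 4 * δ₃) * c) * Lr *
          (Real.sqrt (((((ℓ + 1 : ℕ) : ℝ) ^ (d + 1)) ^ lvl i.hN i.D i.hk y')⁻¹) * (geo9K i).len y') * Real.exp (-(δ₃ / 2 * (geo9K i).dist y y'))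
        = AQ * ((Real.sqrt (((((ℓ + 1 : ℕ) : ℝ) ^ (d + 1)) ^ lvl i.hN i.D i.hk y')⁻¹) * (geo9K i).len y') *
          Real.exp (-(δ₃ / 2 * (geo9K i).dist y y'))) := by rw [hAQ]; ring
      _ ≤ B₄ * ((Real.sqrt (((((ℓ + 1 : ℕ) : ℝ) ^ (d + 1)) ^ lvl i.hN i.D i.hk y')⁻¹) * (geo9K i).len y') *
          Real.exp (-(δ₃ / 2 * (geo9K i).dist y y'))) := mul_le_mul_of_nonneg_right hAQB hX
      _ = _ := by ring
  · have hda : 0 ≤ (geo9K i).dist y y' := hG.dnn y y'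
    have hrate : Real.exp (-(3 / 4 * δ₃ * (geo9K i).dist y y')) ≤ Real.exp (-(δ₃ / 2 * (geo9K i).dist y y')) :=
      Real.exp_le_exp.2 (by nlinarith)
    calc cR39 b * (((d : ℝ) + 1) * (C * c * Real.exp (3 / 4 * δ₃ * 3) * Real.sqrt (Real.exp (1 / 4 * δ₃) * c))) *
          Real.exp (-(3 / 4 * δ₃ * (geo9K i).dist y y'))
        = cR39 b * (AD * Real.exp (-(3 / 4 * δ₃ * (geo9K i).dist y y'))) := by rw [hAD]; ring
      _ ≤ cR39 b * (B₄ * Real.exp (-(δ₃ / 2 * (geo9K i).dist y y'))) :=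
          mul_le_mul_of_nonneg_left (mul_le_mul hADB hrate (Real.exp_pos _).le hB₄pos.le) hcb
      _ = _ := by ring

end Record

end Literature.MathematicalPhysics.QuantumFieldTheory.Balaban1983to89.B9Letters313AtOneL2Dir

end
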